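import Summits.CriticalPhenomena.CardyFormulaZ2.Theorems.CardyComplexConeParafermionToSLESixFamiliesDiamondIdentifyTilted
import Mathlib.Topology.Algebra.Order.Floor
import HarnessLib

/-!
# Line `potential-darboux-picard-diamond`, stub S4′ (`stub_identifyPotentialPh`): corners and edges of a marked diamond in a unimodular frame

Helper file of the stub `stub_identifyPotentialPh` of crux `ParafermionToSLESixFamilies` (stmt-CriticalPhenomena-11389).
Steps (iii)–(iv) of the identification (the closed left-turning boundary chain of the potential limit, and the boundary
correspondence of the Riemann map of the diamond) need an explicit counter-clockwise parametrisation of the frontier of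
a marked diamond (`…DiamondIdentifyLoop`, `exists_boundaryLoop`). This file carries the per-edge computations in
a general unimodular frame `e` with corners `c + conj e · W k`, the corner offsets `W k` (`α − βi, α + βi, −α + βi,
−α − βi`, `4`-periodic, `cornerOffset_spec` — registered anchor of this helper file) entering through their defining
equations: the tilted coordinates of the edge points `P k + r (P (k+1) − P k)` (`edge_coords`), edge points lie on the
frontier (`edge_mem_frontier`) and determine their piece and parameter (`edge_inj`), every frontier point is an edge
point (`exists_edge_of_mem_frontier`), consecutive sides turn left by a right angle and the open rectangle lies strictly
to the left of each directed side (`turn_and_left`).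
-/

noncomputable section

namespace Summit.CriticalPhenomena.CardyFormulaZ2.Cruxes.ParafermionToSLESixFamilies.PotentialDarbouxPicardDiamond

open scoped Topology ComplexConjugate
open Filter Set Metric Complex
open Literature.Probability.RandomPlanarGeometry

/-! ## The corner offsets -/

/-- The corner offsets exist as a `4`-periodic sequence. -/
theorem cornerOffset_spec : ∀ (α β : ℝ), ∃ W : ℕ → ℂ, (∀ k, W (k + 4) = W k) ∧ W 0 = α - β * I ∧ W 1 = α + β * I ∧ W 2 = -α + β * I ∧ W 3 = -α - β * I := by
  intro α β
  refine ⟨fun k => if k % 4 = 0 then α - β * I else if k % 4 = 1 then α + β * I else if k % 4 = 2 then -α + β * I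
    else -α - β * I, fun k => by simp, by simp, by simp, by simp, by simp⟩

/-- Reduction of a `4`-periodic sequence modulo `4`. -/
theorem periodic4_mod {W : ℕ → ℂ} (hW : ∀ k, W (k + 4) = W k) (k : ℕ) : W k = W (k % 4) := by
  conv_lhs => rw [← Nat.mod_add_div k 4]
  generalize k / 4 = n
  induction n with
  | zero => simp
  | succ n ih => rw [Nat.mul_succ, ← add_assoc, hW, ih]

/-- The four cases of three consecutive corner offsets. -/
theorem cornerOffset_cases {α β : ℝ} {W : ℕ → ℂ} (hWper : ∀ k, W (k + 4) = W k) (hW0 : W 0 = α - β * I)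
    (hW1 : W 1 = α + β * I) (hW2 : W 2 = -α + β * I) (hW3 : W 3 = -α - β * I) (k : ℕ) :
    (k % 4 = 0 ∧ W k = α - β * I ∧ W (k + 1) = α + β * I ∧ W (k + 2) = -α + β * I) ∨
      (k % 4 = 1 ∧ W k = α + β * I ∧ W (k + 1) = -α + β * I ∧ W (k + 2) = -α - β * I) ∨
      (k % 4 = 2 ∧ W k = -α + β * I ∧ W (k + 1) = -α - β * I ∧ W (k + 2) = α - β * I) ∨
      (k % 4 = 3 ∧ W k = -α - β * I ∧ W (k + 1) = α - β * I ∧ W (k + 2) = α + β * I) := by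
  have e0 := periodic4_mod hWper k
  have e1 : W (k + 1) = W ((k % 4 + 1) % 4) := by
    rw [periodic4_mod hWper (k + 1)]; congr 1; omega
  have e2 : W (k + 2) = W ((k % 4 + 2) % 4) := by
    rw [periodic4_mod hWper (k + 2)]; congr 1; omega
  have h4 : k % 4 < 4 := Nat.mod_lt _ (by norm_num)
  interval_cases h : k % 4
  · left; exact ⟨rfl, by rw [e0, hW0], by rw [e1]; exact hW1, by rw [e2]; exact hW2⟩
  · right; left; exact ⟨rfl, by rw [e0, hW1], by rw [e1]; exact hW2, by rw [e2]; exact hW3⟩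
  · right; right; left; exact ⟨rfl, by rw [e0, hW2], by rw [e1]; exact hW3, by rw [e2]; exact hW0⟩
  · right; right; right; exact ⟨rfl, by rw [e0, hW3], by rw [e1]; exact hW0, by rw [e2]; exact hW1⟩

/-! ## Frame identities -/

/-- In a unimodular frame `e`, `(z − P) conj (Q − P)` and `(Q′ − Q)/(Q − P)` for corners `c + conj e · W` are read off
the offsets (`conj e · e = 1` drops out), and the tilted coordinate of an edge point is affine in the offsets. -/
theorem frame_identities (c e : ℂ) (he : ‖e‖ = 1) (z W W' W'' : ℂ) (r : ℝ) :
    (z - (c + conj e * W)) * conj ((c + conj e * W') - (c + conj e * W)) = ((z - c) * e - W) * conj (W' - W) ∧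
      ((c + conj e * W'') - (c + conj e * W')) / ((c + conj e * W') - (c + conj e * W)) = (W'' - W') / (W' - W) ∧
      ((c + conj e * W) + (r : ℂ) * ((c + conj e * W') - (c + conj e * W)) - c) * e = W + r * (W' - W) := by
  have hce : conj e * e = 1 := by rw [mul_comm, mul_conj, normSq_eq_norm_sq, he]; simp
  have he0 : conj e ≠ 0 := by
    intro h0; rw [h0, zero_mul] at hce; exact zero_ne_one hce
  refine ⟨?_, ?_, ?_⟩
  · rw [show (c + conj e * W') - (c + conj e * W) = conj e * (W' - W) by ring, map_mul, conj_conj]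
    have h2 : z - (c + conj e * W) = conj e * ((z - c) * e - W) := by
      have : conj e * ((z - c) * e) = (z - c) * (conj e * e) := by ring
      rw [mul_sub, this, hce, mul_one]; ring
    rw [h2, show conj e * ((z - c) * e - W) * (e * conj (W' - W)) = (conj e * e) * (((z - c) * e - W) * conj (W' - W))
      by ring, hce, one_mul]
  · rw [show (c + conj e * W'') - (c + conj e * W') = conj e * (W'' - W') by ring,
      show (c + conj e * W') - (c + conj e * W) = conj e * (W' - W) by ring, mul_div_mul_left _ _ he0]
  · rw [show ((c + conj e * W) + (r : ℂ) * ((c + conj e * W') - (c + conj e * W)) - c) * e =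
      (conj e * e) * (W + r * (W' - W)) by ring, hce, one_mul]

/-- `re` and `im` of `a + b i` for real `a, b`. -/
theorem re_im_ofReal_add_ofReal_mul_I (a b : ℝ) : ((a : ℂ) + (b : ℂ) * I).re = a ∧ ((a : ℂ) + (b : ℂ) * I).im = b := by
  constructor <;> simp

/-- The tilted coordinates of the edge point `P k + r (P (k+1) − P k)`: in the four cases
`(α, −β + 2βr)`, `(α − 2αr, β)`, `(−α, β − 2βr)`, `(−α + 2αr, −β)`. -/
theorem edge_coords (c e : ℂ) (he : ‖e‖ = 1) {α β : ℝ} {W : ℕ → ℂ} (hWper : ∀ k, W (k + 4) = W k)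
    (hW0 : W 0 = α - β * I) (hW1 : W 1 = α + β * I) (hW2 : W 2 = -α + β * I) (hW3 : W 3 = -α - β * I) (k : ℕ)
    (r : ℝ) :
    ∃ A B : ℝ, ((c + conj e * W k) + (r : ℂ) * ((c + conj e * W (k + 1)) - (c + conj e * W k)) - c) * e =
        (A : ℂ) + (B : ℂ) * I ∧
      ((k % 4 = 0 ∧ A = α ∧ B = -β + 2 * β * r) ∨ (k % 4 = 1 ∧ A = α - 2 * α * r ∧ B = β) ∨
        (k % 4 = 2 ∧ A = -α ∧ B = β - 2 * β * r) ∨ (k % 4 = 3 ∧ A = -α + 2 * α * r ∧ B = -β)) := by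
  rw [(frame_identities c e he 0 (W k) (W (k + 1)) 0 r).2.2]
  rcases cornerOffset_cases hWper hW0 hW1 hW2 hW3 k with ⟨h0, hw, hw1, -⟩ | ⟨h0, hw, hw1, -⟩ | ⟨h0, hw, hw1, -⟩ |
    ⟨h0, hw, hw1, -⟩ <;> rw [hw, hw1]
  · exact ⟨α, -β + 2 * β * r, by push_cast; ring, Or.inl ⟨h0, rfl, rfl⟩⟩
  · exact ⟨α - 2 * α * r, β, by push_cast; ring, Or.inr (Or.inl ⟨h0, rfl, rfl⟩)⟩
  · exact ⟨-α, β - 2 * β * r, by push_cast; ring, Or.inr (Or.inr (Or.inl ⟨h0, rfl, rfl⟩))⟩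
  · exact ⟨-α + 2 * α * r, -β, by push_cast; ring, Or.inr (Or.inr (Or.inr ⟨h0, rfl, rfl⟩))⟩

/-- Edge points lie on the frontier of the tilted rectangle. -/
theorem edge_mem_frontier (c e : ℂ) (he : ‖e‖ = 1) {α β : ℝ} (hα : 0 < α) (hβ : 0 < β) {W : ℕ → ℂ}
    (hWper : ∀ k, W (k + 4) = W k) (hW0 : W 0 = α - β * I) (hW1 : W 1 = α + β * I) (hW2 : W 2 = -α + β * I)
    (hW3 : W 3 = -α - β * I) (k : ℕ) {r : ℝ} (hr0 : 0 ≤ r) (hr1 : r ≤ 1) :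
    (c + conj e * W k) + (r : ℂ) * ((c + conj e * W (k + 1)) - (c + conj e * W k)) ∈
      frontier {z : ℂ | |((z - c) * e).re| < α ∧ |((z - c) * e).im| < β} := by
  have he0 : e ≠ 0 := fun h0 => by rw [h0, norm_zero] at he; exact zero_ne_one he
  rw [mem_frontier_tiltedBox_iff c e he0 hα hβ]
  obtain ⟨A, B, hAB, hcases⟩ := edge_coords c e he hWper hW0 hW1 hW2 hW3 k r
  rw [hAB, (re_im_ofReal_add_ofReal_mul_I A B).1, (re_im_ofReal_add_ofReal_mul_I A B).2]
  rcases hcases with ⟨-, rfl, rfl⟩ | ⟨-, rfl, rfl⟩ | ⟨-, rfl, rfl⟩ | ⟨-, rfl, rfl⟩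
  · refine ⟨⟨by rw [abs_of_pos hα], abs_le.2 ⟨by nlinarith, by nlinarith⟩⟩, Or.inl (by rw [abs_of_pos hα])⟩
  · refine ⟨⟨abs_le.2 ⟨by nlinarith, by nlinarith⟩, by rw [abs_of_pos hβ]⟩, Or.inr (by rw [abs_of_pos hβ])⟩
  · refine ⟨⟨by rw [abs_neg, abs_of_pos hα], abs_le.2 ⟨by nlinarith, by nlinarith⟩⟩,
      Or.inl (by rw [abs_neg, abs_of_pos hα])⟩
  · refine ⟨⟨abs_le.2 ⟨by nlinarith, by nlinarith⟩, by rw [abs_neg, abs_of_pos hβ]⟩,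
      Or.inr (by rw [abs_neg, abs_of_pos hβ])⟩

/-- Edge points of one period determine their piece and local parameter. -/
theorem edge_inj (c e : ℂ) (he : ‖e‖ = 1) {α β : ℝ} (hα : 0 < α) (hβ : 0 < β) {W : ℕ → ℂ}
    (hWper : ∀ k, W (k + 4) = W k) (hW0 : W 0 = α - β * I) (hW1 : W 1 = α + β * I) (hW2 : W 2 = -α + β * I)
    (hW3 : W 3 = -α - β * I) {k k' : ℕ} {r r' : ℝ} (hk : k < 4) (hk' : k' < 4) (hr1 : r < 1) (hr1' : r' < 1)
    (heq : (c + conj e * W k) + (r : ℂ) * ((c + conj e * W (k + 1)) - (c + conj e * W k)) =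
      (c + conj e * W k') + (r' : ℂ) * ((c + conj e * W (k' + 1)) - (c + conj e * W k'))) :
    k = k' ∧ r = r' := by
  obtain ⟨A, B, hAB, hc⟩ := edge_coords c e he hWper hW0 hW1 hW2 hW3 k r
  obtain ⟨A', B', hAB', hc'⟩ := edge_coords c e he hWper hW0 hW1 hW2 hW3 k' r'
  have heq' : ((c + conj e * W k) + (r : ℂ) * ((c + conj e * W (k + 1)) - (c + conj e * W k)) - c) * e =
      ((c + conj e * W k') + (r' : ℂ) * ((c + conj e * W (k' + 1)) - (c + conj e * W k')) - c) * e := by rw [heq]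
  rw [hAB, hAB'] at heq'
  have hA : A = A' := by
    have := congrArg Complex.re heq'
    rwa [(re_im_ofReal_add_ofReal_mul_I A B).1, (re_im_ofReal_add_ofReal_mul_I A' B').1] at this
  have hB : B = B' := by
    have := congrArg Complex.im heq'
    rwa [(re_im_ofReal_add_ofReal_mul_I A B).2, (re_im_ofReal_add_ofReal_mul_I A' B').2] at this
  have hmod : k % 4 = k := Nat.mod_eq_of_lt hk
  have hmod' : k' % 4 = k' := Nat.mod_eq_of_lt hk'
  rw [hmod] at hc
  rw [hmod'] at hc'
  rcases hc with ⟨rfl, rfl, rfl⟩ | ⟨rfl, rfl, rfl⟩ | ⟨rfl, rfl, rfl⟩ | ⟨rfl, rfl, rfl⟩ <;>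
  rcases hc' with ⟨rfl, rfl, rfl⟩ | ⟨rfl, rfl, rfl⟩ | ⟨rfl, rfl, rfl⟩ | ⟨rfl, rfl, rfl⟩
  · exact ⟨rfl, mul_left_cancel₀ (show (2 * β : ℝ) ≠ 0 by positivity) (by linarith)⟩
  · exfalso; nlinarith
  · exfalso; nlinarith
  · exfalso; nlinarith
  · exfalso; nlinarith
  · exact ⟨rfl, mul_left_cancel₀ (show (2 * α : ℝ) ≠ 0 by positivity) (by linarith)⟩
  · exfalso; nlinarith
  · exfalso; nlinarith
  · exfalso; nlinarith
  · exfalso; nlinarith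
  · exact ⟨rfl, mul_left_cancel₀ (show (2 * β : ℝ) ≠ 0 by positivity) (by linarith)⟩
  · exfalso; nlinarith
  · exfalso; nlinarith
  · exfalso; nlinarith
  · exfalso; nlinarith
  · exact ⟨rfl, mul_left_cancel₀ (show (2 * α : ℝ) ≠ 0 by positivity) (by linarith)⟩

/-- Every point of the frontier of the tilted rectangle is an edge point. -/
theorem exists_edge_of_mem_frontier (c e : ℂ) (he : ‖e‖ = 1) {α β : ℝ} (hα : 0 < α) (hβ : 0 < β) {W : ℕ → ℂ}
    (hWper : ∀ k, W (k + 4) = W k) (hW0 : W 0 = α - β * I) (hW1 : W 1 = α + β * I) (hW2 : W 2 = -α + β * I)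
    (hW3 : W 3 = -α - β * I) {z : ℂ} (hz : z ∈ frontier {z : ℂ | |((z - c) * e).re| < α ∧ |((z - c) * e).im| < β}) :
    ∃ (k : ℕ) (r : ℝ), k < 4 ∧ 0 ≤ r ∧ r ≤ 1 ∧
      z = (c + conj e * W k) + (r : ℂ) * ((c + conj e * W (k + 1)) - (c + conj e * W k)) := by
  have he0 : e ≠ 0 := fun h0 => by rw [h0, norm_zero] at he; exact zero_ne_one he
  obtain ⟨⟨hX, hY⟩, hside⟩ := (mem_frontier_tiltedBox_iff c e he0 hα hβ z).1 hz
  have hXle := abs_le.1 hX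
  have hYle := abs_le.1 hY
  have hback : ∀ w : ℂ, (w - c) * e = (z - c) * e → z = w := fun w hw => by
    have := mul_right_cancel₀ he0 hw
    linear_combination -this
  -- it suffices to produce `k, r` with the right tilted coordinates
  suffices h : ∃ (k : ℕ) (r : ℝ), k < 4 ∧ 0 ≤ r ∧ r ≤ 1 ∧
      ((c + conj e * W k) + (r : ℂ) * ((c + conj e * W (k + 1)) - (c + conj e * W k)) - c) * e = (z - c) * e by
    obtain ⟨k, r, hk, hr0, hr1, hw⟩ := h
    exact ⟨k, r, hk, hr0, hr1, hback _ hw⟩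
  set X : ℝ := ((z - c) * e).re with hXdef
  set Y : ℝ := ((z - c) * e).im with hYdef
  have hzc : (z - c) * e = (X : ℂ) + (Y : ℂ) * I := (re_add_im _).symm
  have hgoal : ∀ A B : ℝ, A = X → B = Y → (A : ℂ) + (B : ℂ) * I = (z - c) * e := by
    rintro A B rfl rfl; exact hzc.symm
  rcases hside with hXa | hYb
  · rcases le_or_gt 0 X with h0 | h0
    · rw [abs_of_nonneg h0] at hXa
      refine ⟨0, (Y + β) / (2 * β), by norm_num, by apply div_nonneg <;> linarith,
        by rw [div_le_one (by positivity)]; linarith, ?_⟩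
      obtain ⟨A, B, hAB, hc⟩ := edge_coords c e he hWper hW0 hW1 hW2 hW3 0 ((Y + β) / (2 * β))
      rcases hc with ⟨-, rfl, rfl⟩ | ⟨h, -⟩ | ⟨h, -⟩ | ⟨h, -⟩
      · rw [hAB]; exact hgoal _ _ hXa.symm (by field_simp; ring)
      all_goals simp at h
    · rw [abs_of_neg h0] at hXa
      refine ⟨2, (β - Y) / (2 * β), by norm_num, by apply div_nonneg <;> linarith,
        by rw [div_le_one (by positivity)]; linarith, ?_⟩
      obtain ⟨A, B, hAB, hc⟩ := edge_coords c e he hWper hW0 hW1 hW2 hW3 2 ((β - Y) / (2 * β))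
      rcases hc with ⟨h, -⟩ | ⟨h, -⟩ | ⟨-, rfl, rfl⟩ | ⟨h, -⟩
      · simp at h
      · simp at h
      · rw [hAB]; exact hgoal _ _ (by linarith) (by field_simp; ring)
      · simp at h
  · rcases le_or_gt 0 Y with h0 | h0
    · rw [abs_of_nonneg h0] at hYb
      refine ⟨1, (α - X) / (2 * α), by norm_num, by apply div_nonneg <;> linarith,
        by rw [div_le_one (by positivity)]; linarith, ?_⟩
      obtain ⟨A, B, hAB, hc⟩ := edge_coords c e he hWper hW0 hW1 hW2 hW3 1 ((α - X) / (2 * α))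
      rcases hc with ⟨h, -⟩ | ⟨-, rfl, rfl⟩ | ⟨h, -⟩ | ⟨h, -⟩
      · simp at h
      · rw [hAB]; exact hgoal _ _ (by field_simp; ring) hYb.symm
      · simp at h
      · simp at h
    · rw [abs_of_neg h0] at hYb
      refine ⟨3, (X + α) / (2 * α), by norm_num, by apply div_nonneg <;> linarith,
        by rw [div_le_one (by positivity)]; linarith, ?_⟩
      obtain ⟨A, B, hAB, hc⟩ := edge_coords c e he hWper hW0 hW1 hW2 hW3 3 ((X + α) / (2 * α))
      rcases hc with ⟨h, -⟩ | ⟨h, -⟩ | ⟨h, -⟩ | ⟨-, rfl, rfl⟩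
      · simp at h
      · simp at h
      · simp at h
      · rw [hAB]; exact hgoal _ _ (by field_simp; ring) (by linarith)

/-- Consecutive sides turn left by a right angle, and the rectangle lies strictly to the left of each side. -/
theorem turn_and_left (c e : ℂ) (he : ‖e‖ = 1) {α β : ℝ} (hα : 0 < α) (hβ : 0 < β) {W : ℕ → ℂ}
    (hWper : ∀ k, W (k + 4) = W k) (hW0 : W 0 = α - β * I) (hW1 : W 1 = α + β * I) (hW2 : W 2 = -α + β * I)
    (hW3 : W 3 = -α - β * I) (k : ℕ) :
    (∃ ρ : ℝ, 0 < ρ ∧ ((c + conj e * W (k + 2)) - (c + conj e * W (k + 1))) / ((c + conj e * W (k + 1)) -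
      (c + conj e * W k)) = ρ * I) ∧
    ∀ z : ℂ, |((z - c) * e).re| < α → |((z - c) * e).im| < β →
      0 < ((z - (c + conj e * W k)) * conj ((c + conj e * W (k + 1)) - (c + conj e * W k))).im := by
  have hαc : (α : ℂ) ≠ 0 := by exact_mod_cast hα.ne'
  have hβc : (β : ℂ) ≠ 0 := by exact_mod_cast hβ.ne'
  constructor
  · rw [(frame_identities c e he 0 (W k) (W (k + 1)) (W (k + 2)) 0).2.1]
    rcases cornerOffset_cases hWper hW0 hW1 hW2 hW3 k with ⟨-, hw, hw1, hw2⟩ | ⟨-, hw, hw1, hw2⟩ |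
      ⟨-, hw, hw1, hw2⟩ | ⟨-, hw, hw1, hw2⟩ <;> rw [hw, hw1, hw2]
    · refine ⟨α / β, div_pos hα hβ, ?_⟩
      have hne : ((α : ℂ) + β * I - (α - β * I)) ≠ 0 := by
        rw [show ((α : ℂ) + β * I - (α - β * I)) = 2 * β * I by ring]
        exact mul_ne_zero (mul_ne_zero two_ne_zero hβc) I_ne_zero
      rw [div_eq_iff hne]
      push_cast; field_simp; ring_nf; rw [I_sq]; ring
    · refine ⟨β / α, div_pos hβ hα, ?_⟩
      have hne : (-(α : ℂ) + β * I - (α + β * I)) ≠ 0 := by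
        rw [show (-(α : ℂ) + β * I - (α + β * I)) = -2 * α by ring]; exact mul_ne_zero (by norm_num) hαc
      rw [div_eq_iff hne]
      push_cast; field_simp; ring_nf
    · refine ⟨α / β, div_pos hα hβ, ?_⟩
      have hne : (-(α : ℂ) - β * I - (-α + β * I)) ≠ 0 := by
        rw [show (-(α : ℂ) - β * I - (-α + β * I)) = -2 * β * I by ring]
        exact mul_ne_zero (mul_ne_zero (by norm_num) hβc) I_ne_zero
      rw [div_eq_iff hne]
      push_cast; field_simp; ring_nf; rw [I_sq]; ring
    · refine ⟨β / α, div_pos hβ hα, ?_⟩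
      have hne : ((α : ℂ) - β * I - (-α - β * I)) ≠ 0 := by
        rw [show ((α : ℂ) - β * I - (-α - β * I)) = 2 * α by ring]; exact mul_ne_zero (by norm_num) hαc
      rw [div_eq_iff hne]
      push_cast; field_simp; ring_nf
  · intro z hXa hYb
    set X : ℝ := ((z - c) * e).re with hXdef
    set Y : ℝ := ((z - c) * e).im with hYdef
    have hX := abs_lt.1 hXa
    have hY := abs_lt.1 hYb
    rw [(frame_identities c e he z (W k) (W (k + 1)) 0 0).1]
    have hzc : (z - c) * e = (X : ℂ) + (Y : ℂ) * I := (re_add_im _).symm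
    rw [hzc]
    rcases cornerOffset_cases hWper hW0 hW1 hW2 hW3 k with ⟨-, hw, hw1, -⟩ | ⟨-, hw, hw1, -⟩ | ⟨-, hw, hw1, -⟩ |
      ⟨-, hw, hw1, -⟩ <;> rw [hw, hw1] <;> simp [mul_im, sub_re, sub_im] <;> nlinarith

end Summit.CriticalPhenomena.CardyFormulaZ2.Cruxes.ParafermionToSLESixFamilies.PotentialDarbouxPicardDiamond

end
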